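import Summits.Ventures.PercRepro.C026CutVertexB3
import Summits.Ventures.PercRepro.C026PFunCutVertexB

/-!
# The remaining cut vertices: a mark-free side, and a live vertex as the cut vertex (p6, gen 21)

The last two cases of mine-3's block lemma (MINE3-GLUING §39 (d) (iii)–(iv)) for the corner identity
`(E00)` of THEOREM L2, on p5's cut-vertex dictionary (`C026CutVertex`): `v` is a cut vertex of the
two-colouring `side` (`IsGluing v v v side`), `G₁ = G.part side true`, `G₂ = G.part side false`.

* **A mark-free side** (`pFun_liveCells_eq_cut_free`): if the probe and both live vertices lie on side
  `true` (or are `v`), every connection among them is decided on side `true`, every type count of `G`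
  is the corresponding count of `G₁` times the number `2^{|E₂|}` of configurations of the other side, and
  `(P_G)(0,0) = 2^{|E₂|} · (P_{G₁})(0,0)` — so `(E00)(G) ↔ (E00)(G₁)` (`pFun_liveCells_nonneg_iff_of_cut_free`).
* **A live vertex as the cut vertex** (`slackCF_nonneg_of_cut_live`): if the live vertex `a` itself
  separates the probe `c` (side `false`) from the other live vertex `b` (side `true`), then
  `Δ_CF(G; a, b, c) = #{a ≁ b}(G₁) · #{c ~ a}(G₂) ≥ 0`: the cells `ab|c = #{a ~ b}₁·#{a ≁ c}₂`,
  `ac|b = #{a ≁ b}₁·#{c ~ a}₂`, `bc|a = ∅` and `N_AB = #{a ~ b}₁·#{c ≁̄ a}₂` with `#{c ≁̄ a}₂ = #{c ≁ a}₂`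
  (complementation on side `false`).  So `(CF)`, hence `(E00)` and THEOREM L2, hold unconditionally on
  every skeleton in which a live vertex is a cut vertex between the probe and the other live vertex
  (`pFun_threeCells_nonneg_of_cut_live`, and `_cut_live'` for the live vertex `b`).

With C026PFunCutVertex (the cut vertex separates the probe from the live vertices), C026PFunCutVertexB
(it separates a live vertex from the rest) and p5's B5 (the probe is the cut vertex,
`slackCF_nonneg_of_cut_c`), every cut vertex of a skeleton now transfers THEOREM L2 to its blocks.
-/

namespace PercRepro

namespace MultiGraph

open Finset

variable {V E : Type*} {G : MultiGraph V E}

section Free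

variable [Fintype E] {v : V} {side : E → Bool}

open Classical in
/-- A count whose condition lives on side `true` alone is the side-`true` count times the number of
side-`false` configurations. -/
theorem card_filter_true_side (P : Config {e // side e = true} → Prop) :
    (univ.filter fun ω : Config E => P (sideRestrict ω side true)).card =
      (univ.filter P).card * (univ : Finset (Config {e // side e = false})).card := by
  have h := card_filter_cut side P (fun _ => True)
  simp only [and_true] at h
  convert h using 3
  ext x
  simp

variable [Fintype V] [DecidableEq V]

open Classical in
/-- **A mark-free side is a free factor**: with the probe and the live vertices on side `true` (or
equal to the cut vertex), `(P_G)(0,0) = 2^{|E₂|} · (P_{G₁})(0,0)`. -/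
theorem pFun_liveCells_eq_cut_free (hg : G.IsGluing v v v side) {a b c : V}
    (ha : a = v ∨ G.OnSide side true a) (hb : b = v ∨ G.OnSide side true b)
    (hc : c = v ∨ G.OnSide side true c) :
    G.pFun c (liveCells a b) (liveCells a b) univ =
      ((univ : Finset (Config {e // side e = false})).card : ℝ) *
        (G.part side true).pFun c (liveCells a b) (liveCells a b) univ := by
  have htf : true ≠ false := by decide
  -- the dictionary: every connection among the marks is decided on side `true`, in both colours
  have dr : ∀ (x y : V), (x = v ∨ G.OnSide side true x) → (y = v ∨ G.OnSide side true y) →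
      ∀ ω : Config E, G.Conn ω x y ↔ (G.part side true).Conn (sideRestrict ω side true) x y :=
    fun x y hx hy ω => conn_cut_iff_same hg htf hx hy ω
  have db : ∀ (x y : V), (x = v ∨ G.OnSide side true x) → (y = v ∨ G.OnSide side true y) →
      ∀ ω : Config E, G.Conn ωᶜ x y ↔ (G.part side true).Conn (sideRestrict ω side true)ᶜ x y :=
    fun x y hx hy ω => by rw [conn_cut_iff_same hg htf hx hy ωᶜ, sideRestrict_compl]
  -- the five counts
  have h1 : (univ.filter fun ω : Config E => G.Conn ω a b ∧ ¬ G.Conn ω a c).card =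
      (univ.filter fun ω₁ : Config {e // side e = true} =>
        (G.part side true).Conn ω₁ a b ∧ ¬ (G.part side true).Conn ω₁ a c).card *
        (univ : Finset (Config {e // side e = false})).card := by
    have hfilt : (univ.filter fun ω : Config E => G.Conn ω a b ∧ ¬ G.Conn ω a c) =
        univ.filter fun ω : Config E =>
          (G.part side true).Conn (sideRestrict ω side true) a b ∧
            ¬ (G.part side true).Conn (sideRestrict ω side true) a c :=
      filter_congr fun ω _ => by rw [dr a b ha hb, dr a c ha hc]
    rw [hfilt]
    convert card_filter_true_side (fun ω₁ => (G.part side true).Conn ω₁ a b ∧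
      ¬ (G.part side true).Conn ω₁ a c) using 5
  have h2 : (univ.filter fun ω : Config E => G.Conn ω c a ∧ ¬ G.Conn ω c b).card =
      (univ.filter fun ω₁ : Config {e // side e = true} =>
        (G.part side true).Conn ω₁ c a ∧ ¬ (G.part side true).Conn ω₁ c b).card *
        (univ : Finset (Config {e // side e = false})).card := by
    have hfilt : (univ.filter fun ω : Config E => G.Conn ω c a ∧ ¬ G.Conn ω c b) =
        univ.filter fun ω : Config E =>
          (G.part side true).Conn (sideRestrict ω side true) c a ∧
            ¬ (G.part side true).Conn (sideRestrict ω side true) c b :=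
      filter_congr fun ω _ => by rw [dr c a hc ha, dr c b hc hb]
    rw [hfilt]
    convert card_filter_true_side (fun ω₁ => (G.part side true).Conn ω₁ c a ∧
      ¬ (G.part side true).Conn ω₁ c b) using 5
  have h3 : (univ.filter fun ω : Config E => G.Conn ω c b ∧ ¬ G.Conn ω c a).card =
      (univ.filter fun ω₁ : Config {e // side e = true} =>
        (G.part side true).Conn ω₁ c b ∧ ¬ (G.part side true).Conn ω₁ c a).card *
        (univ : Finset (Config {e // side e = false})).card := by
    have hfilt : (univ.filter fun ω : Config E => G.Conn ω c b ∧ ¬ G.Conn ω c a) =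
        univ.filter fun ω : Config E =>
          (G.part side true).Conn (sideRestrict ω side true) c b ∧
            ¬ (G.part side true).Conn (sideRestrict ω side true) c a :=
      filter_congr fun ω _ => by rw [dr c a hc ha, dr c b hc hb]
    rw [hfilt]
    convert card_filter_true_side (fun ω₁ => (G.part side true).Conn ω₁ c b ∧
      ¬ (G.part side true).Conn ω₁ c a) using 5
  have h4 : (univ.filter fun ω : Config E =>
        G.Conn ω a b ∧ ¬ G.Conn ωᶜ c a ∧ ¬ G.Conn ωᶜ c b).card =
      (univ.filter fun ω₁ : Config {e // side e = true} =>
        (G.part side true).Conn ω₁ a b ∧ ¬ (G.part side true).Conn ω₁ᶜ c a ∧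
          ¬ (G.part side true).Conn ω₁ᶜ c b).card *
        (univ : Finset (Config {e // side e = false})).card := by
    have hfilt : (univ.filter fun ω : Config E =>
          G.Conn ω a b ∧ ¬ G.Conn ωᶜ c a ∧ ¬ G.Conn ωᶜ c b) =
        univ.filter fun ω : Config E =>
          (G.part side true).Conn (sideRestrict ω side true) a b ∧
            ¬ (G.part side true).Conn (sideRestrict ω side true)ᶜ c a ∧
              ¬ (G.part side true).Conn (sideRestrict ω side true)ᶜ c b :=
      filter_congr fun ω _ => by rw [dr a b ha hb, db c a hc ha, db c b hc hb]
    rw [hfilt]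
    convert card_filter_true_side (fun ω₁ => (G.part side true).Conn ω₁ a b ∧
      ¬ (G.part side true).Conn ω₁ᶜ c a ∧ ¬ (G.part side true).Conn ω₁ᶜ c b) using 5
  have h5 : (univ.filter fun ω : Config E => G.Conn ω c a ∧ G.Conn ω c b).card =
      (univ.filter fun ω₁ : Config {e // side e = true} =>
        (G.part side true).Conn ω₁ c a ∧ (G.part side true).Conn ω₁ c b).card *
        (univ : Finset (Config {e // side e = false})).card := by
    have hfilt : (univ.filter fun ω : Config E => G.Conn ω c a ∧ G.Conn ω c b) =
        univ.filter fun ω : Config E =>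
          (G.part side true).Conn (sideRestrict ω side true) c a ∧
            (G.part side true).Conn (sideRestrict ω side true) c b :=
      filter_congr fun ω _ => by rw [dr c a hc ha, dr c b hc hb]
    rw [hfilt]
    convert card_filter_true_side (fun ω₁ => (G.part side true).Conn ω₁ c a ∧
      (G.part side true).Conn ω₁ c b) using 5
  -- the slacks in this file's instances
  have hS : (G.slackCF a b c : ℝ) =
      ((univ.filter fun ω : Config E => G.Conn ω a b ∧ ¬ G.Conn ω a c).card : ℝ) +
        ((univ.filter fun ω : Config E => G.Conn ω c a ∧ ¬ G.Conn ω c b).card : ℝ) +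
        ((univ.filter fun ω : Config E => G.Conn ω c b ∧ ¬ G.Conn ω c a).card : ℝ) -
        ((univ.filter fun ω : Config E =>
          G.Conn ω a b ∧ ¬ G.Conn ωᶜ c a ∧ ¬ G.Conn ωᶜ c b).card : ℝ) := by
    unfold slackCF
    push_cast
    congr!
  have hS₁ : ((G.part side true).slackCF a b c : ℝ) =
      ((univ.filter fun ω₁ : Config {e // side e = true} =>
        (G.part side true).Conn ω₁ a b ∧ ¬ (G.part side true).Conn ω₁ a c).card : ℝ) +
        ((univ.filter fun ω₁ : Config {e // side e = true} =>
          (G.part side true).Conn ω₁ c a ∧ ¬ (G.part side true).Conn ω₁ c b).card : ℝ) +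
        ((univ.filter fun ω₁ : Config {e // side e = true} =>
          (G.part side true).Conn ω₁ c b ∧ ¬ (G.part side true).Conn ω₁ c a).card : ℝ) -
        ((univ.filter fun ω₁ : Config {e // side e = true} =>
          (G.part side true).Conn ω₁ a b ∧ ¬ (G.part side true).Conn ω₁ᶜ c a ∧
            ¬ (G.part side true).Conn ω₁ᶜ c b).card : ℝ) := by
    unfold slackCF
    push_cast
    congr!
  rw [pFun_liveCells_eq, pFun_liveCells_eq, hS, hS₁, h1, h2, h3, h4, h5]
  push_cast
  ring

open Classical in
/-- `(E00)` is unchanged by a mark-free side. -/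
theorem pFun_liveCells_nonneg_iff_of_cut_free (hg : G.IsGluing v v v side) {a b c : V}
    (ha : a = v ∨ G.OnSide side true a) (hb : b = v ∨ G.OnSide side true b)
    (hc : c = v ∨ G.OnSide side true c) :
    0 ≤ G.pFun c (liveCells a b) (liveCells a b) univ ↔
      0 ≤ (G.part side true).pFun c (liveCells a b) (liveCells a b) univ := by
  rw [pFun_liveCells_eq_cut_free hg ha hb hc]
  exact mul_nonneg_iff_of_pos_left (Nat.cast_pos.2 (card_pos.2 ⟨⊥, mem_univ _⟩))

end Free

section Live

variable [Fintype E] {side : E → Bool}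

open Classical in
/-- **A live vertex as the cut vertex**: if `a` separates the probe `c` (side `false`) from the other
live vertex `b` (side `true`), the C-026 slack is `#{a ≁ b}(G₁) · #{c ~ a}(G₂) ≥ 0`. -/
theorem slackCF_eq_of_cut_live {a b c : V} (hg : G.IsGluing a a a side)
    (hb : G.OnSide side true b) (hc : G.OnSide side false c) (hcb : c ≠ b) :
    G.slackCF a b c =
      ((univ.filter fun ω₁ : Config {e // side e = true} =>
        ¬ (G.part side true).Conn ω₁ a b).card : ℤ) *
        ((univ.filter fun ω₂ : Config {e // side e = false} =>
          (G.part side false).Conn ω₂ c a).card : ℤ) := by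
  have htf : true ≠ false := by decide
  have hft : false ≠ true := by decide
  -- the dictionary at the marks (`a` is the cut vertex)
  have dab : ∀ ω : Config E, G.Conn ω a b ↔
      (G.part side true).Conn (sideRestrict ω side true) a b :=
    fun ω => conn_cut_iff_same hg htf (Or.inl rfl) (Or.inr hb) ω
  have dca : ∀ ω : Config E, G.Conn ω c a ↔
      (G.part side false).Conn (sideRestrict ω side false) c a :=
    fun ω => conn_cut_iff_same hg hft (Or.inr hc) (Or.inl rfl) ω
  have dcb : ∀ ω : Config E, G.Conn ω c b ↔
      (G.part side false).Conn (sideRestrict ω side false) c a ∧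
        (G.part side true).Conn (sideRestrict ω side true) a b :=
    fun ω => conn_cut_iff_cross hg hft (Or.inr hc) hb hcb ω
  -- the four cells
  have h1 : (univ.filter fun ω : Config E => G.Conn ω a b ∧ ¬ G.Conn ω a c).card =
      (univ.filter fun ω₁ : Config {e // side e = true} =>
        (G.part side true).Conn ω₁ a b).card *
        (univ.filter fun ω₂ : Config {e // side e = false} =>
          ¬ (G.part side false).Conn ω₂ c a).card := by
    have hfilt : (univ.filter fun ω : Config E => G.Conn ω a b ∧ ¬ G.Conn ω a c) =
        univ.filter fun ω : Config E =>
          (G.part side true).Conn (sideRestrict ω side true) a b ∧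
            ¬ (G.part side false).Conn (sideRestrict ω side false) c a :=
      filter_congr fun ω _ => by rw [dab, conn_comm (u := a) (v := c), dca]
    rw [hfilt]
    convert card_filter_cut side (fun ω₁ => (G.part side true).Conn ω₁ a b)
      (fun ω₂ => ¬ (G.part side false).Conn ω₂ c a) using 5
  have h2 : (univ.filter fun ω : Config E => G.Conn ω c a ∧ ¬ G.Conn ω c b).card =
      (univ.filter fun ω₁ : Config {e // side e = true} =>
        ¬ (G.part side true).Conn ω₁ a b).card *
        (univ.filter fun ω₂ : Config {e // side e = false} =>
          (G.part side false).Conn ω₂ c a).card := by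
    have hfilt : (univ.filter fun ω : Config E => G.Conn ω c a ∧ ¬ G.Conn ω c b) =
        univ.filter fun ω : Config E =>
          ¬ (G.part side true).Conn (sideRestrict ω side true) a b ∧
            (G.part side false).Conn (sideRestrict ω side false) c a :=
      filter_congr fun ω _ => by rw [dca, dcb]; tauto
    rw [hfilt]
    convert card_filter_cut side (fun ω₁ => ¬ (G.part side true).Conn ω₁ a b)
      (fun ω₂ => (G.part side false).Conn ω₂ c a) using 5
  have h3 : (univ.filter fun ω : Config E => G.Conn ω c b ∧ ¬ G.Conn ω c a).card = 0 := by
    rw [card_eq_zero, filter_eq_empty_iff]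
    intro ω _ h
    exact h.2 ((dca ω).2 ((dcb ω).1 h.1).1)
  have h4 : (univ.filter fun ω : Config E =>
        G.Conn ω a b ∧ ¬ G.Conn ωᶜ c a ∧ ¬ G.Conn ωᶜ c b).card =
      (univ.filter fun ω₁ : Config {e // side e = true} =>
        (G.part side true).Conn ω₁ a b).card *
        (univ.filter fun ω₂ : Config {e // side e = false} =>
          ¬ (G.part side false).Conn ω₂ᶜ c a).card := by
    have hfilt : (univ.filter fun ω : Config E =>
          G.Conn ω a b ∧ ¬ G.Conn ωᶜ c a ∧ ¬ G.Conn ωᶜ c b) =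
        univ.filter fun ω : Config E =>
          (G.part side true).Conn (sideRestrict ω side true) a b ∧
            ¬ (G.part side false).Conn (sideRestrict ω side false)ᶜ c a :=
      filter_congr fun ω _ => by
        rw [dab, dca ωᶜ, dcb ωᶜ, sideRestrict_compl, sideRestrict_compl]
        tauto
    rw [hfilt]
    convert card_filter_cut side (fun ω₁ => (G.part side true).Conn ω₁ a b)
      (fun ω₂ => ¬ (G.part side false).Conn ω₂ᶜ c a) using 5
  -- complementation on side `false`: `#{c ≁̄ a} = #{c ≁ a}`
  have h5 : (univ.filter fun ω₂ : Config {e // side e = false} =>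
        ¬ (G.part side false).Conn ω₂ᶜ c a).card =
      (univ.filter fun ω₂ : Config {e // side e = false} =>
        ¬ (G.part side false).Conn ω₂ c a).card :=
    card_filter_compl_eq _ _ fun ω₂ => Iff.rfl
  unfold slackCF
  rw [h1, h2, h3, h4, h5]
  push_cast
  ring

open Classical in
/-- **`(CF)` holds when a live vertex is a cut vertex between the probe and the other live vertex.** -/
theorem slackCF_nonneg_of_cut_live {a b c : V} (hg : G.IsGluing a a a side)
    (hb : G.OnSide side true b) (hc : G.OnSide side false c) (hcb : c ≠ b) :
    0 ≤ G.slackCF a b c := by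
  rw [slackCF_eq_of_cut_live hg hb hc hcb]
  positivity

variable [Fintype V] [DecidableEq V]

open Classical in
/-- THEOREM L2 on every skeleton in which the live vertex `a` is a cut vertex between the probe and the
live vertex `b`. -/
theorem pFun_threeCells_nonneg_of_cut_live {a b c : V} (hg : G.IsGluing a a a side)
    (hb : G.OnSide side true b) (hc : G.OnSide side false c) (hcb : c ≠ b)
    {z κ x₁ K₁ x₂ K₂ : ℝ} (hz : 0 ≤ z ∧ z ≤ 1) (hκ : kMin z ≤ κ) (hx₁ : 0 ≤ x₁ ∧ x₁ ≤ 1)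
    (hx₂ : 0 ≤ x₂ ∧ x₂ ≤ 1) (hK₁ : kMin x₁ ≤ K₁) (hK₂ : kMin x₂ ≤ K₂) :
    0 ≤ G.pFun c (threeCells c a b z x₁ x₂) (threeCells c a b κ K₁ K₂) univ :=
  pFun_threeCells_nonneg_of_E00 c a b hz hκ hx₁ hx₂ hK₁ hK₂
    (pFun_liveCells_nonneg_of_slackCF a b c (slackCF_nonneg_of_cut_live hg hb hc hcb))

open Classical in
/-- THEOREM L2 on every skeleton in which the live vertex `b` is a cut vertex between the probe and the
live vertex `a`. -/
theorem pFun_threeCells_nonneg_of_cut_live' {a b c : V} (hg : G.IsGluing b b b side)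
    (ha : G.OnSide side true a) (hc : G.OnSide side false c) (hca : c ≠ a)
    {z κ x₁ K₁ x₂ K₂ : ℝ} (hz : 0 ≤ z ∧ z ≤ 1) (hκ : kMin z ≤ κ) (hx₁ : 0 ≤ x₁ ∧ x₁ ≤ 1)
    (hx₂ : 0 ≤ x₂ ∧ x₂ ≤ 1) (hK₁ : kMin x₁ ≤ K₁) (hK₂ : kMin x₂ ≤ K₂) :
    0 ≤ G.pFun c (threeCells c a b z x₁ x₂) (threeCells c a b κ K₁ K₂) univ := by
  rw [threeCells_comm c a b z x₁ x₂, threeCells_comm c a b κ K₁ K₂]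
  exact pFun_threeCells_nonneg_of_cut_live hg ha hc hca hz hκ hx₂ hx₁ hK₂ hK₁

end Live

end MultiGraph

end PercRepro
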